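import Mathlib.Analysis.Matrix.Order
import Mathlib.Analysis.Matrix.Hermitian
import Mathlib.LinearAlgebra.Matrix.ToLinearEquiv
import Mathlib.Algebra.MvPolynomial.Funext
import Literature.Combinatorics.StablePolynomials.Basic
import HarnessLib

/-!
# Determinantal pencils `det(z_1 A_1 + ⋯ + z_m A_m + B)` are real stable or zero
# (Borcea–Brändén–Liggett, Proposition 3.2 (1))

J. Borcea, P. Brändén, T. M. Liggett, *Negative dependence and the geometry of polynomials*, J. Amer. Math.
Soc. 22 (2009) 521–567 (arXiv:0707.2340, held `paper:arxiv-0707.2340`; numbering of the arXiv version), §3.1.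
Verbatim:

> **Proposition 3.2.** Let `A_1, …, A_m` be (complex) positive semi-definite matrices and let `B` be a (complex)
> Hermitian matrix, all matrices being of the same size. (1) The polynomial
> `z = (z_1, …, z_m) ↦ f(z) = det(z_1 A_1 + ⋯ + z_m A_m + B)` is either identically zero or real stable; […]
> *Proof* [of (1), with `z(t) = λt + μ`, `λ ∈ ℝ_+^m`, `μ ∈ ℝ^m`]: […] where `H := B + Σ_j μ_j A_j` is a Hermitian
> matrix. Therefore, `f(z(t))` is a polynomial in `t` that is a constant multiple of the characteristic
> polynomial of a Hermitian matrix and so it must have all real zeros. By the first part of Proposition 3.1,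
> this proves (1) […]. □

## Route (same positivity, pointwise; no line restriction and no limiting argument)

For `z ∈ ℋ^σ` write `L(z) = Σ_j z_j A_j + B`. If `L(z) v = 0` then `0 = v* L(z) v = Σ_j z_j · v*A_j v + v*Bv` with
`v*A_j v ≥ 0` and `v*Bv` real; the imaginary part `Σ_j Im(z_j) v*A_j v = 0` forces every `v*A_j v = 0`, hence
`A_j v = 0` (positive semidefiniteness) and then `Bv = 0`. So a single zero of `f` in `ℋ^σ` produces a common
kernel vector, `L(w) v = 0` for every `w`, and `f ≡ 0`. (The printed proof needs `Σ λ_j A_j` invertible to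
speak of a characteristic polynomial and a density argument otherwise; the kernel argument covers the
semidefinite case directly.) "Real": `conj f = det(L(z)ᵀ) = f` coefficientwise, since `A_j`, `B` are Hermitian.

## Contents

* §1 `affinePencilMatrix A B` (entries `Σ_j A_j[p,q] z_j + B[p,q] ∈ R[z_σ]`), `detAffinePencil A B` (any commutative ring `R`),
  `affinePencilMatrix_map_eval`, `map_detAffinePencil`, **`eval_detAffinePencil`** (`f(z) = det(Σ z_j A_j + B)`),
  `star_dotProduct_pencil_mulVec`.
* §2 `pencil_mulVec_eq_zero_imp`, `pencil_mulVec_eq_zero_forall` (the kernel argument).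
* §3 **`detAffinePencil_eq_zero_or_isUpperHalfPlaneStable`** (Prop. 3.2 (1), complex Hermitian data),
  `affinePencilMatrix_map_conj`, `conj_coeff_detAffinePencil`, `coeff_detAffinePencil_im` (real coefficients).
* §4 **`detAffinePencil_eq_zero_or_isRealStable`** (Prop. 3.2 (1) for real symmetric data,
  in the tree's `IsRealStable` vocabulary).

## References

* [BorceaBrandenLiggett2007] J. Borcea, P. Brändén, T. M. Liggett, Negative dependence and the geometry of
  polynomials, J. Amer. Math. Soc. 22 (2009), 521–567; arXiv:0707.2340 — §3.1 Prop. 3.2.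
* [BorceaBranden2009] J. Borcea, P. Brändén, The Lee–Yang and Pólya–Schur programs I, Invent. Math. 177 (2009)
  (Prop. 1.12: the same statement).
* Related tree file: `Literature/AlgebraicGeometry/HyperbolicPolynomials/DeterminantalPencil.lean` (the homogeneous
  pencil `det(Σ_j z_j A_j)` without affine term, hyperbolicity w.r.t. a definite direction — BBL §4.1 example (IV)).
-/

noncomputable section

open Matrix MvPolynomial Finset
open scoped ComplexOrder ComplexConjugate

namespace Literature.Combinatorics.StablePolynomials

variable {σ : Type*} [Fintype σ] {n : Type*} [Fintype n] [DecidableEq n] {R : Type*} [CommRing R]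

/-! ## §1 The pencil `Σ_j z_j A_j + B` with polynomial entries and its determinant -/

section Pencil

/-- **The linear matrix pencil** `L(z) = Σ_j z_j A_j + B` as a matrix with entries in `R[z_σ]`.
[cite: BorceaBrandenLiggett2007, §3.1 Prop. 3.2 (the polynomial `det(z_1 A_1 + ⋯ + z_m A_m + B)`)] -/
def affinePencilMatrix (A : σ → Matrix n n R) (B : Matrix n n R) : Matrix n n (MvPolynomial σ R) :=
  fun p q => ∑ j, C (A j p q) * X j + C (B p q)

/-- **`f(z) = det(z_1 A_1 + ⋯ + z_m A_m + B)`** as a polynomial in `R[z_σ]`.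
[cite: BorceaBrandenLiggett2007, §3.1 Prop. 3.2 (1)] -/
def detAffinePencil (A : σ → Matrix n n R) (B : Matrix n n R) : MvPolynomial σ R := (affinePencilMatrix A B).det

omit [DecidableEq n] [Fintype n] in
/-- Unfolding the entries of the pencil. [cite: BorceaBrandenLiggett2007, §3.1 Prop. 3.2] -/
theorem affinePencilMatrix_apply (A : σ → Matrix n n R) (B : Matrix n n R) (p q : n) :
    affinePencilMatrix A B p q = ∑ j, C (A j p q) * X j + C (B p q) := rfl

omit [DecidableEq n] [Fintype n] in
/-- Evaluating the entries at `z`: `L(z) = Σ_j z_j A_j + B`. [cite: BorceaBrandenLiggett2007, §3.1 Prop. 3.2] -/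
theorem affinePencilMatrix_map_eval (A : σ → Matrix n n R) (B : Matrix n n R) (z : σ → R) :
    (affinePencilMatrix A B).map (eval z) = ∑ j, z j • A j + B := by
  ext p q
  simp only [map_apply, affinePencilMatrix_apply, map_add, map_sum, map_mul, eval_C, eval_X, Matrix.add_apply,
    Matrix.sum_apply, Matrix.smul_apply, smul_eq_mul]
  congr 1
  exact Finset.sum_congr rfl fun j _ => mul_comm _ _

/-- Changing scalars along a ring map. [cite: BorceaBrandenLiggett2007, §3.1 Prop. 3.2] -/
theorem map_detAffinePencil {S : Type*} [CommRing S] (f : R →+* S) (A : σ → Matrix n n R) (B : Matrix n n R) :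
    MvPolynomial.map f (detAffinePencil A B) = detAffinePencil (fun j => (A j).map f) (B.map f) := by
  rw [detAffinePencil, RingHom.map_det, RingHom.mapMatrix_apply, detAffinePencil]
  congr 1
  ext p q : 2
  simp only [map_apply, affinePencilMatrix_apply, map_add, map_sum, map_mul, map_C, map_X]

/-- **`f(z) = det(Σ_j z_j A_j + B)`** pointwise. [cite: BorceaBrandenLiggett2007, §3.1 Prop. 3.2 (1)] -/
theorem eval_detAffinePencil (A : σ → Matrix n n R) (B : Matrix n n R) (z : σ → R) :
    eval z (detAffinePencil A B) = (∑ j, z j • A j + B).det := by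
  rw [detAffinePencil, RingHom.map_det, RingHom.mapMatrix_apply, affinePencilMatrix_map_eval]

omit [DecidableEq n] in
/-- The quadratic form of the pencil splits: `v* L(z) v = Σ_j z_j · v* A_j v + v* B v`.
[cite: BorceaBrandenLiggett2007, §3.1 proof of Prop. 3.2] -/
theorem star_dotProduct_pencil_mulVec (A : σ → Matrix n n ℂ) (B : Matrix n n ℂ) (z : σ → ℂ) (v : n → ℂ) :
    star v ⬝ᵥ ((∑ j, z j • A j + B) *ᵥ v) = ∑ j, z j * (star v ⬝ᵥ (A j *ᵥ v)) + star v ⬝ᵥ (B *ᵥ v) := by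
  rw [add_mulVec, dotProduct_add, sum_mulVec, dotProduct_sum]
  refine congrArg₂ (· + ·) (Finset.sum_congr rfl fun j _ => ?_) rfl
  rw [smul_mulVec, dotProduct_smul, smul_eq_mul]

end Pencil

/-! ## §2 The kernel argument: a zero in `ℋ^σ` forces a common kernel vector -/

section Kernel

omit [DecidableEq n] in
/-- **Key step.** If `A_j ⪰ 0`, `B` is Hermitian, `z ∈ ℋ^σ` and `L(z) v = 0`, then `A_j v = 0` for every `j` and
`B v = 0`: from `0 = v* L(z) v = Σ_j z_j (v* A_j v) + v* B v` with `v* A_j v ≥ 0`, `v* B v ∈ ℝ`, the imaginary part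
gives `Σ_j Im(z_j) v* A_j v = 0`, so each `v* A_j v = 0`, i.e. `A_j v = 0`. (BBL argue on the line `z(t) = λt + μ`
through the characteristic polynomial of a Hermitian matrix; this is the same positivity, pointwise.)
[cite: BorceaBrandenLiggett2007, §3.1 proof of Prop. 3.2 ("`H := B + Σ_j μ_j A_j` is a Hermitian matrix")] -/
theorem pencil_mulVec_eq_zero_imp {A : σ → Matrix n n ℂ} {B : Matrix n n ℂ} (hA : ∀ j, (A j).PosSemidef)
    (hB : B.IsHermitian) {z : σ → ℂ} (hz : ∀ j, 0 < (z j).im) {v : n → ℂ}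
    (hv : (∑ j, z j • A j + B) *ᵥ v = 0) : (∀ j, A j *ᵥ v = 0) ∧ B *ᵥ v = 0 := by
  have hq : star v ⬝ᵥ ((∑ j, z j • A j + B) *ᵥ v) = 0 := by rw [hv, dotProduct_zero]
  rw [star_dotProduct_pencil_mulVec] at hq
  -- the quadratic forms `q_j = v* A_j v` are real and nonnegative, `b = v* B v` is real
  have hqre : ∀ j, 0 ≤ (star v ⬝ᵥ (A j *ᵥ v)).re := fun j => (hA j).re_dotProduct_nonneg v
  have hqim : ∀ j, (star v ⬝ᵥ (A j *ᵥ v)).im = 0 := fun j => (hA j).1.im_star_dotProduct_mulVec_self v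
  have hbim : (star v ⬝ᵥ (B *ᵥ v)).im = 0 := hB.im_star_dotProduct_mulVec_self v
  -- imaginary part of the identity
  have him := congrArg Complex.im hq
  rw [Complex.add_im, Complex.im_sum, hbim, add_zero, Complex.zero_im] at him
  have hterm : ∀ j, (z j * (star v ⬝ᵥ (A j *ᵥ v))).im = (z j).im * (star v ⬝ᵥ (A j *ᵥ v)).re := by
    intro j
    rw [Complex.mul_im, hqim j, mul_zero, zero_add, mul_comm]
  simp only [hterm] at him
  have hzero : ∀ j, (z j).im * (star v ⬝ᵥ (A j *ᵥ v)).re = 0 := fun j =>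
    (Finset.sum_eq_zero_iff_of_nonneg fun j _ => mul_nonneg (hz j).le (hqre j)).1 him j (Finset.mem_univ j)
  have hAv : ∀ j, A j *ᵥ v = 0 := by
    intro j
    have hre : (star v ⬝ᵥ (A j *ᵥ v)).re = 0 := (mul_eq_zero.1 (hzero j)).resolve_left (hz j).ne'
    exact ((hA j).dotProduct_mulVec_zero_iff v).1 (Complex.ext hre (hqim j))
  refine ⟨hAv, ?_⟩
  have h := hv
  rw [add_mulVec, sum_mulVec] at h
  simpa only [smul_mulVec, hAv, smul_zero, Finset.sum_const_zero, zero_add] using h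

omit [DecidableEq n] in
/-- Consequently such a `v` kills the pencil everywhere: `L(w) v = 0` for all `w ∈ ℂ^σ`.
[cite: BorceaBrandenLiggett2007, §3.1 proof of Prop. 3.2] -/
theorem pencil_mulVec_eq_zero_forall {A : σ → Matrix n n ℂ} {B : Matrix n n ℂ} (hA : ∀ j, (A j).PosSemidef)
    (hB : B.IsHermitian) {z : σ → ℂ} (hz : ∀ j, 0 < (z j).im) {v : n → ℂ}
    (hv : (∑ j, z j • A j + B) *ᵥ v = 0) (w : σ → ℂ) : (∑ j, w j • A j + B) *ᵥ v = 0 := by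
  obtain ⟨hAv, hBv⟩ := pencil_mulVec_eq_zero_imp hA hB hz hv
  rw [add_mulVec, sum_mulVec, hBv, add_zero]
  exact Finset.sum_eq_zero fun j _ => by rw [smul_mulVec, hAv j, smul_zero]

end Kernel

/-! ## §3 Proposition 3.2 (1) -/

section Prop32

/-- **Borcea–Brändén–Liggett, Proposition 3.2 (1)** (Borcea–Brändén [BB-I] Prop. 1.12). "Let `A_1, …, A_m` be
(complex) positive semi-definite matrices and let `B` be a (complex) Hermitian matrix, all matrices being of
the same size. (1) The polynomial `z ↦ f(z) = det(z_1 A_1 + ⋯ + z_m A_m + B)` is either identically zero or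
real stable" — the stability half: `f = 0` or `f` has no zero in `ℋ^σ`. Proof: a zero `z ∈ ℋ^σ` gives `v ≠ 0`
with `L(z) v = 0`, hence (§2) `L(w) v = 0` for all `w`, so `f ≡ 0`. [cite: BorceaBrandenLiggett2007, §3.1
Prop. 3.2 (1)] -/
theorem detAffinePencil_eq_zero_or_isUpperHalfPlaneStable {A : σ → Matrix n n ℂ} {B : Matrix n n ℂ}
    (hA : ∀ j, (A j).PosSemidef) (hB : B.IsHermitian) :
    detAffinePencil A B = 0 ∨ IsUpperHalfPlaneStable (detAffinePencil A B) := by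
  classical
  by_cases h : ∃ z : σ → ℂ, (∀ j, 0 < (z j).im) ∧ eval z (detAffinePencil A B) = 0
  · left
    obtain ⟨z, hz, h0⟩ := h
    rw [eval_detAffinePencil] at h0
    obtain ⟨v, hv0, hv⟩ := (Matrix.exists_mulVec_eq_zero_iff).2 h0
    refine MvPolynomial.funext fun w => ?_
    rw [eval_detAffinePencil, map_zero]
    exact (Matrix.exists_mulVec_eq_zero_iff).1 ⟨v, hv0, pencil_mulVec_eq_zero_forall hA hB hz hv w⟩
  · right
    intro z hz h0
    exact h ⟨z, hz, h0⟩

omit [DecidableEq n] [Fintype n] in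
/-- Conjugating the coefficients of the pencil transposes it (`A_j`, `B` Hermitian). [cite: BorceaBrandenLiggett2007,
§3.1 Prop. 3.2] -/
theorem affinePencilMatrix_map_conj {A : σ → Matrix n n ℂ} {B : Matrix n n ℂ} (hA : ∀ j, (A j).IsHermitian)
    (hB : B.IsHermitian) :
    (affinePencilMatrix A B).map (MvPolynomial.map (starRingEnd ℂ)) = (affinePencilMatrix A B)ᵀ := by
  ext p q : 2
  simp only [map_apply, transpose_apply, affinePencilMatrix_apply, map_add, map_sum, map_mul, map_C, map_X]
  have hA' : ∀ j, (starRingEnd ℂ) (A j p q) = A j q p := fun j => by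
    simpa [conjTranspose_apply] using congrFun (congrFun (hA j).eq q) p
  have hB' : (starRingEnd ℂ) (B p q) = B q p := by
    simpa [conjTranspose_apply] using congrFun (congrFun hB.eq q) p
  simp only [hA', hB']

/-- **Proposition 3.2 (1), the "real" half**: `f = det(Σ z_j A_j + B)` has real coefficients
(`conj f = det(L(z)ᵀ) = f`). [cite: BorceaBrandenLiggett2007, §3.1 Prop. 3.2 (1) ("real stable")] -/
theorem conj_coeff_detAffinePencil {A : σ → Matrix n n ℂ} {B : Matrix n n ℂ} (hA : ∀ j, (A j).IsHermitian)
    (hB : B.IsHermitian) (m : σ →₀ ℕ) : conj (coeff m (detAffinePencil A B)) = coeff m (detAffinePencil A B) := by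
  have h : MvPolynomial.map (starRingEnd ℂ) (detAffinePencil A B) = detAffinePencil A B := by
    rw [detAffinePencil, RingHom.map_det, RingHom.mapMatrix_apply, affinePencilMatrix_map_conj hA hB, det_transpose]
  have := congrArg (coeff m) h
  rwa [coeff_map] at this

/-- The coefficients of `f` are real numbers: `Im [z^m] f = 0`. [cite: BorceaBrandenLiggett2007, §3.1 Prop. 3.2 (1)] -/
theorem coeff_detAffinePencil_im {A : σ → Matrix n n ℂ} {B : Matrix n n ℂ} (hA : ∀ j, (A j).IsHermitian)
    (hB : B.IsHermitian) (m : σ →₀ ℕ) : (coeff m (detAffinePencil A B)).im = 0 := by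
  have h := congrArg Complex.im (conj_coeff_detAffinePencil hA hB m)
  rw [Complex.conj_im] at h
  linarith

end Prop32

/-! ## §4 Real symmetric data: `IsRealStable` form -/

section Real

omit [DecidableEq n] in
/-- A real positive semidefinite matrix stays positive semidefinite over `ℂ` (`x* A x = uᵀ A u + wᵀ A w` for
`x = u + i w`). [folklore] -/
private theorem posSemidef_map_ofReal {A : Matrix n n ℝ} (hA : A.PosSemidef) : (A.map (algebraMap ℝ ℂ)).PosSemidef := by
  have hH : (A.map (algebraMap ℝ ℂ)).IsHermitian := hA.1.map (algebraMap ℝ ℂ) (fun r => by simp)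
  refine PosSemidef.of_dotProduct_mulVec_nonneg hH fun x => ?_
  set u : n → ℝ := fun p => (x p).re with hu
  set w : n → ℝ := fun p => (x p).im with hw
  have hyre : ∀ p, ((A.map (algebraMap ℝ ℂ) *ᵥ x) p).re = (A *ᵥ u) p := fun p => by
    simp only [mulVec, dotProduct, map_apply, Complex.re_sum, Complex.coe_algebraMap, Complex.re_ofReal_mul, hu]
  have hyim : ∀ p, ((A.map (algebraMap ℝ ℂ) *ᵥ x) p).im = (A *ᵥ w) p := fun p => by
    simp only [mulVec, dotProduct, map_apply, Complex.im_sum, Complex.coe_algebraMap, Complex.im_ofReal_mul, hw]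
  have hre : (star x ⬝ᵥ (A.map (algebraMap ℝ ℂ) *ᵥ x)).re = u ⬝ᵥ (A *ᵥ u) + w ⬝ᵥ (A *ᵥ w) := by
    rw [dotProduct, Complex.re_sum, dotProduct, dotProduct, ← Finset.sum_add_distrib]
    refine Finset.sum_congr rfl fun p _ => ?_
    rw [Complex.mul_re, hyre, hyim, Pi.star_apply, Complex.star_def, Complex.conj_re, Complex.conj_im]
    simp only [hu, hw]
    ring
  have him : (star x ⬝ᵥ (A.map (algebraMap ℝ ℂ) *ᵥ x)).im = 0 := hH.im_star_dotProduct_mulVec_self x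
  have hval : star x ⬝ᵥ (A.map (algebraMap ℝ ℂ) *ᵥ x) = ((u ⬝ᵥ (A *ᵥ u) + w ⬝ᵥ (A *ᵥ w) : ℝ) : ℂ) :=
    Complex.ext (by rw [hre, Complex.ofReal_re]) (by rw [him, Complex.ofReal_im])
  rw [hval, Complex.zero_le_real]
  exact add_nonneg (hA.dotProduct_mulVec_nonneg u) (hA.dotProduct_mulVec_nonneg w)

/-- **Proposition 3.2 (1) for real symmetric data**: for real positive semidefinite `A_j` and real symmetric `B`,
`det(Σ z_j A_j + B) ∈ ℝ[z_σ]` is zero or real stable. [cite: BorceaBrandenLiggett2007, §3.1 Prop. 3.2 (1)] -/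
theorem detAffinePencil_eq_zero_or_isRealStable {A : σ → Matrix n n ℝ} {B : Matrix n n ℝ}
    (hA : ∀ j, (A j).PosSemidef) (hB : B.IsHermitian) :
    detAffinePencil A B = 0 ∨ IsRealStable (detAffinePencil A B) := by
  rcases detAffinePencil_eq_zero_or_isUpperHalfPlaneStable (fun j => posSemidef_map_ofReal (hA j))
    (hB.map (algebraMap ℝ ℂ) fun r => by simp) with h0 | hst
  · left
    rw [← map_detAffinePencil] at h0
    exact MvPolynomial.map_injective _ (RingHom.injective _) (by rw [h0, map_zero])
  · right
    rw [IsRealStable, map_detAffinePencil]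
    exact hst

end Real

end Literature.Combinatorics.StablePolynomials

end
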